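import Summits.QuantumFields.BalabanUV.T4Continuum.Support.NE9RemainderSpeciesMargProj

/-!
# NE9AnalyticClassMargProj — the MARGINAL-PROJECTION leaf (row MP, `hPinto`) DISCHARGED for ANY class-relative piece form whose
# per-piece bound is proved ON THE ANALYTIC CLASS: the two END-M read-out faces of `NE9RemainderSpeciesMargProj` (p213217 §3/§4)
# made DATUM-GENERIC, so that the ray species (`RemData`, p212850), the curve species of the owner's LOCATED CORRECTION
# O-ne9p1g25-1 (`CurData`, `NE9Lemma1CurveSpecies`) and any later re-typing of the (1.23)-datum are ONE-LINE instances
# (cell `pub-balaban`, T4-DAG §2 node U3 / §6 NE9; NE9 formalisation swarm, unit `b2b-balaban-t4-ne9-formalise-leaf-04` gen 6 —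
# the datum-free half of crew row (w21)-MP of the owner g25's list, journal l.9603 / INTENT l.9736)

HONEST FRAMING (T4-DAG PAGE 1).  Rung (B)+1 of the FINITE-VOLUME T⁴ programme — NOT infinite volume, NOT a mass gap, NOT the
Clay problem.  NE9 (`T4OutputRate.NE9` ∧ `FadingMemory`) is a cell NEW ESTIMATE, NOT PRINTED, NOT discharged here; spine 0/9;
0/18 skeleton leaves instantiated on Bałaban's objects (O-NE9-1).  HONEST DEPENDENCY (cell line, verbatim): continuum YM on T⁴
⇐ BetaPertH ∧ nine spine estimates (0/9 proved); BetaPertH ⇐ (D1) ∧ (D4) ∧ CAP+tail; G-an2-4 gates asym, D1 and NE2/3/4.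
`FlowStep.BetaPertH`, (B), (B^μ) do not occur.  [I] = [Balaban1987RG1] (CMP **109**), [II] = [Balaban1988RG2Cluster]
(CMP **116**) are quoted for TYPES only (ABSOLUTE RULE: nothing printed in the audited series is asserted).

WHY (the owner's located findings O-ne9p1g22-1 → g23-1 → g24-1 → g25-1 each RE-TYPED the datum of the displayed species —
encoding, rate letter, class-relative piece form, ray ↦ curve — while every landed implication stayed correct).  Lineage gen 5's
MP discharge at the species (`NE9RemainderSpeciesMargProj`, p213217) was written against the RAY datum `RemData`; the owner g25
(journal l.9603, `NE9Lemma1CurveRemainder` p213669 / `NE9Lemma1CurveSpecies`) found that for non-abelian `G` the σ-disc of [I]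
Lemma 4 (3.53)–(3.54) p. 280 maps to an analytic CURVE `σ ↦ U_j(□₀, exp iσB)|_X` ((3.30) p. 276, (3.37) p. 277), a ray only for
abelian `G`, and asked for the crew twins at the curve datum `CurData` (crew row (w21)).  But the MP discharge never reads the
datum: it uses exactly (i) `Adm ⊆ analyticClass R` and the closure of the analytic class under the read-out projection
(p213217 §1/§2, datum-free), and (ii) a per-piece bound `PieceBoundOnG (analyticClass R) P …` PROVED ON THE ANALYTIC CLASS
(the owner's `pieceBoundOnG_rem` for the ray datum, `pieceBoundOnG_cur` for the curve datum), restricted to the marginal-free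
class by antitonicity.  THIS FILE records the two faces at that generality — for ANY class-relative piece form
`P : CPieceData (doubleCarriers C₀) E ι α β γ` on the re/im-doubled carriers with backgrounds in a complex normed configuration
chart `E`, and ANY radius function `R`:
* §1 **`termSize_ne9_and_fadingMemory_analytic_margProj_cpieceForm`** = p213217 §3 with `D.toC ↦ P`, `D.R ↦ R`, `D.κ₁ ↦ κ₁`,
  `KpOf D c_dir ↦ Kp`, `ℓ⁵ ↦ gain`, and the species lemmas `pieceZero_rem`/`pieceLocal_rem`/`csrcScale_rem`/`pieceBoundOnG_rem`/
  `kpOf_nonneg` ↦ the DISPLAYED binders `hP0 : PieceZero P`, `hloc : PieceLocal P`, `hsrc : CSrcScale P`,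
  **`hPieceAn : PieceBoundOnG (analyticClass R) P κ κ₁ d₀ Kp gain`**, `hKp`, `hgain`: leaf-09-g4's END-M face at form level
  (`NE9CPieceCouplingModulus.…_margProj_cpieceForm`, p212551) APPLIED BY NAME with **MP's `ProjInto Adm MF (margProj r A)` :=
  p213217 §2 `projInto_margProj_analytic`** at `MF := {H | H ∈ analyticClass R ∧ H ∈ S ∧ ∀ j, r_j(H↾j) = 0}`, S5 on `MF` :=
  `hPieceAn` restricted (`pieceBoundOnG_mono`), the additivity binders on `Adm`/`MF` := the ONE displayed
  `PieceAdditiveOn (analyticClass R) P` restricted.  GONE versus p212551 §4: `hPinto hPiece hadd haddMF`.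
* §2 **`termSize_ne9_and_fadingMemory_analytic_margProj`** = p213217 §4 at the same generality: END-M's `…_compProj` face
  (`NE9MarginalProjectionEnd`) APPLIED BY NAME at `𝒯 := cpieceChannel P`, `P := margProj r A`, `MF` as above, `c := cr·aA`,
  `wt := weightOf P.frame κ₁ d₀ O1 Kp`, `τ := tauOfG c_Q (agePow ω)`, with `ChannelStepSum MF 𝒯` := `channelStepSum_cpiece`,
  `ChannelSizeAtStepNN MF 𝒯 κ wt τ` := the owner's `channelSizeAtStepNN_cpieceG` from `hPieceAn` restricted to `MF`,
  `ChannelAdditive MF 𝒯` := `channelAdditive_cpiece` from the displayed `PieceAdditiveOn (analyticClass R) P` restricted, the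
  profile from `profileG` (τ̄ = c_Q), and the four projection binders := `projAdditive_margProj` / `projScaleComm_margProj` /
  **p213217 §2** / `projSize_margProj` — the route of the owner's part 3 (`NE9Lemma1RemainderSpeciesEnd`, p213009) composed with
  END-M's own route from `…_compProj` to `…_margProj`, datum-free; leaf A3 displayed as `hTcup`.
INSTANCES (not in this file, BY-NAME one-liners): ray datum — §1/§2 at `P := D.toC`, `R := D.R`, `κ₁ := D.κ₁`, `Kp := KpOf D
c_dir`, `gain := ℓ⁵` with `pieceZero_rem D`, `pieceLocal_rem D`, `csrcScale_rem hD`, `pieceBoundOnG_rem hD hℓ κ`, `kpOf_nonneg hD`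
ARE p213217 §3/§4 (kernel-checked in the lineage probe `HOME/t4/b2b-balaban-t4-ne9-formalise-leaf-04/g6/xread/
ProbeAnalyticClassMargProjRay.lean`); curve datum — the same with the owner's `…_cur` lemmas (crew row (w21)-MP, sibling module
`NE9CurveSpeciesMargProj` once `NE9Lemma1CurveSpecies` is in the tree).
DISPLAYED on these faces (honest list): O1-type data (`P`, the carriers, `R`, `r`, `A`, `S`, `Ψ`, `act`, `ρ`, …), the piece
form's structure binders `hP0 hloc hsrc`, ITS PER-PIECE BOUND ON THE ANALYTIC CLASS `hPieceAn` (for Bałaban's (1.23)-pieces: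
(I.3.54) ⊕ [II] (1.24)–(1.25) under the domain inclusion (I.3.36)/(3.53) — TYPE, proved by the owner for the typed data
modulo their `Admissible` binders), the level counts `LevelCountsG` ((1.26)–(1.28)), `Adm ⊆ analyticClass R`, AW (`DirSize A κ
aA`, `A ∈ analyticClass R`, `hAmul`), RO (`hrA hr0 hrs` + ray-homogeneity `hcoef` + NORMALISATION `hnorm` — O1's number), the
S-closure `hS`, `PieceAdditiveOn (analyticClass R) P` (crew rows (w16)/(w19)), in §1 the per-piece coupling responses
`hrespE`/`hrespA` (leaf A3; crew row (w20) for the curve datum), in §2 `hTcup`; and END-M's A1/A2/R/G/N binders VERBATIM.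
DISGUISE TEST: one input family, one read-out, one marginal direction, set algebra of classes + the END applied by name — no
history comparison is proved here; not NE9.

References (TYPES only): [Balaban1987RG1] T. Bałaban, *Renormalization group approach to lattice gauge field theories. I*,
Commun. Math. Phys. **109** (1987) 249–301 — (0.28)–(0.30) p. 258, (1.3) p. 260, (1.11)–(1.14) p. 262, (1.18) p. 263,
(1.20)–(1.22) p. 264, (3.30) p. 276, (3.36)–(3.37) p. 277, Lemma 4 (3.53)–(3.54) p. 280; [Balaban1988RG2Cluster] T. Bałaban,
*… II. Cluster expansions*, Commun. Math. Phys. **116** (1988) 1–22 — (1.23)–(1.29) pp. 7–8, (1.33)–(1.36) p. 9.  Summits-side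
NEW work (LEAN PLACEMENT RULE); imports p213217 (hence p213009/p212850/p212277/p212551/p210502 and `NE9MarginalProjectionEnd`)
BY NAME; modifies nothing; 0 sorry; 0 `def`.  Value = the MP binder removed from the displayed list of the END-M read-out faces
for EVERY class-relative piece form bounded on the analytic class (modulo O1's normalisation number and the read-out's
ray-homogeneity) — bookkeeping robust under re-typing of the datum, NOT summit progress.
-/

noncomputable section

namespace Summit.QuantumFields.BalabanUV.T4Continuum.NE9AnalyticClassMargProj

open scoped BigOperators
open Metric Set
open Literature.MathematicalPhysics.QuantumFieldTheory.Balaban1983to89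
open Literature.MathematicalPhysics.QuantumFieldTheory.Balaban1983to89.T4OutputRate
open Literature.MathematicalPhysics.QuantumFieldTheory.Balaban1983to89.T4HistoryLipschitzRecursion
open Literature.MathematicalPhysics.QuantumFieldTheory.Balaban1983to89.T4HistoryLipschitzOuter
open Literature.MathematicalPhysics.QuantumFieldTheory.Balaban1983to89.T4HistoryLipschitzActivity
open Literature.MathematicalPhysics.QuantumFieldTheory.Balaban1983to89.T4HistoryLipschitzActivity (ClusterGeom)
open Literature.MathematicalPhysics.QuantumFieldTheory.Balaban1983to89.T4HistoryLipschitzSegment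
open Summit.QuantumFields.BalabanUV.T4Continuum.NE9Lemma1Counting
open Summit.QuantumFields.BalabanUV.T4Continuum.NE9Lemma1Gain
open Summit.QuantumFields.BalabanUV.T4Continuum.NE9Lemma1PieceClass
open Summit.QuantumFields.BalabanUV.T4Continuum.NE9Lemma1RemainderSpecies (analyticClass)
open Summit.QuantumFields.BalabanUV.T4Continuum.NE9Lemma1RemainderSpeciesEnd
open Summit.QuantumFields.BalabanUV.T4Continuum.NE9ComplexEncoding (doubleCarriers)
open Summit.QuantumFields.BalabanUV.T4Continuum.NE9LastCouplingBridge
open Summit.QuantumFields.BalabanUV.T4Continuum.NE9BridgeSizeInduction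
open Summit.QuantumFields.BalabanUV.T4Continuum.NE9MarginalProjection
open Summit.QuantumFields.BalabanUV.T4Continuum.NE9MarginalProjectionEnd
open Summit.QuantumFields.BalabanUV.T4Continuum.NE9CPieceCouplingModulus
open Summit.QuantumFields.BalabanUV.T4Continuum.NE9RemainderSpeciesMargProj

variable {C₀ : Carriers} {E : Type} [NormedAddCommGroup E] [NormedSpace ℂ E] {ι α β γ : Type}
variable (G : ClusterGeom (doubleCarriers C₀)) {Pot : Type*} [NormedAddCommGroup Pot] [NormedSpace ℂ Pot]

/-! ## §1 The END-M read-out face for a piece form bounded on the analytic class — MP / S-sum / S5 discharged -/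

/-- **NE9 ∧ FADING MEMORY ∧ TERM SIZE ON THE v1.3 DICTIONARY FOR A CLASS-RELATIVE PIECE FORM BOUNDED ON THE ANALYTIC CLASS —
rows MP, S-sum, S5 DISCHARGED (kernel end-to-end; datum-generic form of p213217 §3).**  leaf-09-g4's END-M face at form level
`…_margProj_cpieceForm` (p212551) APPLIED BY NAME at the marginal-free class `MF := {H | H ∈ analyticClass R ∧ H ∈ S ∧ ∀ j,
r_j(H↾j) = 0}` with: S5's `PieceBoundOnG MF P …` := the DISPLAYED per-piece bound ON THE ANALYTIC CLASS `hPieceAn` restricted to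
`MF`; **MP's `ProjInto Adm MF (margProj r A)` := p213217 §2 `projInto_margProj_analytic`** (from `Adm ⊆ analyticClass R` — S1-type,
[I] (1.18) p. 263 —, `A ∈ analyticClass R` + `hAmul` — AW-type, (1.11)–(1.14) p. 262 —, the read-out's additivity,
ray-homogeneity and NORMALISATION, and the S-closure); the additivity binders on `Adm` and on `MF` := the ONE displayed
`PieceAdditiveOn (analyticClass R) P` restricted.  DISPLAYED: `hP0 hloc hsrc hPieceAn hKp hgain`, `LevelCountsG`, `Adm ⊆
analyticClass R`, AW, RO (+ `hcoef`, `hnorm`), `hS`, the per-piece coupling responses `hrespE`/`hrespA` (leaf A3), and every other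
END-M binder VERBATIM.  Conclusion = END-M's with `τbar := c_Q`, `qTbar := (qc + cr·Nbar·qcA)·c_Q·(1−ω)⁻¹`.  Instances: ray datum
(`P := D.toC`, the owner's `…_rem` lemmas) = p213217 §3; curve datum (`…_cur`) = crew row (w21)-MP.  Nothing of [I]–[II]
asserted; NE9 NOT PROVED; 0/9 unchanged.
[cite: Balaban1987RG1, (0.28)-(0.30) p.258, (1.3) p.260, (1.18) p.263, (1.20)-(1.22) p.264, (3.53)-(3.54) p.280; Balaban1988RG2Cluster, (1.23)-(1.29) pp.7-8, (1.33)-(1.36) p.9] -/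
theorem termSize_ne9_and_fadingMemory_analytic_margProj_cpieceForm
    (P : CPieceData (doubleCarriers C₀) E ι α β γ) {R : C₀.Dom → ℝ} {Kp : ℕ → ι → ℝ} {gain : ℕ → ℕ → ℝ}
    {Ef : Functional (doubleCarriers C₀) E} {W : Set (ℕ → ℝ)} {Adm S : Set (E → (doubleCarriers C₀).Dom → ℝ)}
    {r : ℕ → (E → (doubleCarriers C₀).Dom → ℝ) → ℝ} {A : E → (doubleCarriers C₀).Dom → ℝ}
    {Ψ : ℕ → ℝ → (ι → ℝ) → E → (doubleCarriers C₀).Dom → ℝ} {act : ℕ → ℝ → E → Pot → G.P → ℂ} {𝒜 : ℕ → Set Pot}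
    {n : ℕ → ℝ → E → G.P → ℝ} {lip clip : ℕ → ℝ} {a d : G.P → ℝ} {δv : (doubleCarriers C₀).Dom → ℝ}
    {κ κ₁ d0 O1 cQ ω qc qcA Nbar B lipbar clipbar cr aA : ℝ} {p₀ N : ℕ → ℝ}
    (ρ : ℕ → (ι → ℝ) → Pot) (U₀ : E) (explZ : ℕ → E → (doubleCarriers C₀).Dom → ℝ) (h0 : ScaleZeroFree Ef W)
    (hAdm : AdmissibleTerms Ef W Adm) (hres : AdmRestrict Adm)
    -- the piece form's structure binders and ITS PER-PIECE BOUND ON THE ANALYTIC CLASS (displayed; for the typed data the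
    -- owner's `pieceZero_…`/`pieceLocal_…`/`csrcScale_…`/`pieceBoundOnG_…`), the level counts, the class inclusion
    (hP0 : PieceZero P) (hloc : PieceLocal P) (hsrc : CSrcScale P)
    (hPieceAn : PieceBoundOnG (analyticClass R) P κ κ₁ d0 Kp gain) (hKp : ∀ k y, 0 ≤ Kp k y) (hgain : ∀ k j, 0 ≤ gain k j)
    (hL : LevelCountsG P.frame κ κ₁ O1 cQ gain (agePow ω))
    (hAdmAn : Adm ⊆ analyticClass R)
    -- additivity of the pieces on the analytic class (displayed; crew rows (w16)/(w19))
    (hA16 : PieceAdditiveOn (analyticClass R) P)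
    -- the read-out and the marginal direction (END-M's RO / AW binders, verbatim) …
    (hrA : ReadAdditive Adm r) (hr0 : ReadZero r) (hrs : ReadSize Adm r κ cr) (hA : DirSize A κ aA) (hcr : 0 ≤ cr)
    (haA : 0 ≤ aA)
    -- … and what MP needs of them: analyticity of `A`, its scale-wise multiples admissible (p212551's `hAmul`),
    -- ray-homogeneity and NORMALISATION of the read-out, the closure of the structural class `S` under the projection
    (hAan : A ∈ analyticClass R)
    (hAmul : ∀ c : ℕ → ℝ, (fun U X' => c ((doubleCarriers C₀).scale X') * A U X') ∈ Adm)
    (hcoef : ∀ (j : ℕ) (c : ℝ), r j (restrictScale j (c • A)) = c * r j (restrictScale j A))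
    (hnorm : ∀ j : ℕ, r j (restrictScale j A) = 1 ∨ ∀ H ∈ Adm, r j (restrictScale j H) = 0)
    (hS : ∀ H ∈ Adm, margProj r A H ∈ S)
    -- leaf A3: the per-piece coupling responses of the terms and of the multiples of `A` (displayed)
    (hrespE : ∀ g ∈ W, ∀ g' ∈ W, ∀ (k : ℕ) (y : ι), ∀ a' ∈ P.S0 k y, ∀ b ∈ P.SY k y a', ∀ (j : ℕ), ∀ x ∈ P.src k y a' j,
      |P.piece k g y a' b x (Ef g) - P.piece k g' y a' b x (Ef g)| ≤
        Kp k y * qc * gain k j * Real.exp (-(κ * (doubleCarriers C₀).d x)) *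
          Real.exp (-(1 / 8) * (κ₁ - 1) * P.dY k y + (1 / 8) * κ₁ * d0 - (1 / 2) * (κ₁ - 1) * P.vol k y a' b) *
            |g k - g' k|)
    (hrespA : ∀ g ∈ W, ∀ g' ∈ W, ∀ (k : ℕ) (y : ι), ∀ a' ∈ P.S0 k y, ∀ b ∈ P.SY k y a', ∀ (j : ℕ), ∀ x ∈ P.src k y a' j,
      ∀ c : ℕ → ℝ,
      |P.piece k g y a' b x (fun U X => c ((doubleCarriers C₀).scale X) * A U X) -
          P.piece k g' y a' b x (fun U X => c ((doubleCarriers C₀).scale X) * A U X)| ≤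
        |c ((doubleCarriers C₀).scale x)| * (Kp k y * qcA * gain k j * Real.exp (-(κ * (doubleCarriers C₀).d x)) *
          Real.exp (-(1 / 8) * (κ₁ - 1) * P.dY k y + (1 / 8) * κ₁ * d0 - (1 / 2) * (κ₁ - 1) * P.vol k y a' b) *
            |g k - g' k|))
    (hqc : 0 ≤ qc) (hqcA : 0 ≤ qcA) (hO1 : 0 ≤ O1) (hcQ : 0 ≤ cQ) (hω0 : 0 ≤ ω) (hω1 : ω < 1) (hNb : ∀ j, N j ≤ Nbar)
    -- END-M's remaining binders at `T := cpieceChannel P ∘ margProj r A`, verbatim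
    (hfac : Factorises Ef W (compProj (cpieceChannel P) (margProj r A)) Ψ) (hclip0 : ∀ k, 0 ≤ clip k)
    (hCup : ∀ g ∈ W, ∀ g' ∈ W, ∀ (k : ℕ) (U : E) (X : (doubleCarriers C₀).Dom), (doubleCarriers C₀).scale X = k + 1 →
      ∀ Q ∈ 𝒜 k, ∀ γ' ∈ G.vol X,
      ‖act k (g k) U Q γ'‖ ≤ n k (g' k) U γ' ∧
        ‖act k (g k) U Q γ' - act k (g' k) U Q γ'‖ ≤ clip k * |g k - g' k| * n k (g' k) U γ')
    (hreprV : ∀ (k : ℕ) (s : ℝ) (Q : ι → ℝ) (U : E) (X : (doubleCarriers C₀).Dom),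
      Ψ k s Q U X = (G.newTerm act k s U X (ρ k Q)).re - (G.newTerm act k s U₀ X (ρ k Q)).re + explZ k U X)
    (hclipb : ∀ k, clip k ≤ clipbar)
    (hK : TwoPointKP G W act 𝒜 n lip a d) (hdec : G.DecayExtract δv d) (hpin : G.PinBudget a δv (fun _ => B) κ)
    (hρ : ∀ (k : ℕ) (Q Q' : ι → ℝ) (M : ℝ),
      (∀ y, |Q y - Q' y| ≤ weightOf P.frame κ₁ d0 O1 Kp k y * M) → ‖ρ k Q - ρ k Q'‖ ≤ M)
    (hexplZ : ∀ (k : ℕ) (U : E) (X : (doubleCarriers C₀).Dom), (doubleCarriers C₀).scale X = k + 1 →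
      |explZ k U X| ≤ Real.exp (-(κ * (doubleCarriers C₀).d X)) * p₀ k)
    (hbase : ∀ g ∈ W, ∀ (U : E) (X : (doubleCarriers C₀).Dom), (doubleCarriers C₀).scale X = 0 →
      |Ef g U X| ≤ Real.exp (-(κ * (doubleCarriers C₀).d X)) * N 0)
    (hNsucc : ∀ j, p₀ j + 2 * B ≤ N (j + 1)) (hNnn : ∀ j, 0 ≤ N j)
    (hbox : ∀ (k : ℕ) (Q : ι → ℝ),
      (∀ y, |Q y| ≤ weightOf P.frame κ₁ d0 O1 Kp k y *
        sizeRadius (fun k j => (1 + cr * aA) * tauOfG cQ (agePow ω) k j) N k) → ρ k Q ∈ 𝒜 k)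
    (hB : 0 ≤ B) (hlipb : ∀ k, lip k ≤ lipbar) (hpos : 0 < ω + 8 * lipbar * B * ((1 + cr * aA) * cQ)) :
    TermSize Ef W κ N ∧
      NE9 Ef W κ (prodModuli (8 * clipbar * B + 8 * lipbar * B * ((qc + cr * Nbar * qcA) * cQ * (1 - ω)⁻¹))
        fun _ => ω + 8 * lipbar * B * ((1 + cr * aA) * cQ)) ∧
        FadingMemory ((8 * clipbar * B + 8 * lipbar * B * ((qc + cr * Nbar * qcA) * cQ * (1 - ω)⁻¹)) /
            (ω + 8 * lipbar * B * ((1 + cr * aA) * cQ)))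
          (ω + 8 * lipbar * B * ((1 + cr * aA) * cQ))
          (prodModuli (8 * clipbar * B + 8 * lipbar * B * ((qc + cr * Nbar * qcA) * cQ * (1 - ω)⁻¹))
            fun _ => ω + 8 * lipbar * B * ((1 + cr * aA) * cQ)) := by
  -- MP (p213217 §2) and the class inclusion
  have hPinto : ProjInto Adm {H | H ∈ analyticClass R ∧ H ∈ S ∧ ∀ j, r j (restrictScale j H) = 0} (margProj r A) :=
    projInto_margProj_analytic hAdmAn hAan hAmul hrA hcoef hnorm hS
  have hMF := margFree_subset_analyticClass (E := E) R S r
  -- S5 on MF from the DISPLAYED per-piece bound on the analytic class; additivity restricted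
  have hPiece : PieceBoundOnG {H | H ∈ analyticClass R ∧ H ∈ S ∧ ∀ j, r j (restrictScale j H) = 0} P κ κ₁ d0 Kp gain :=
    pieceBoundOnG_mono hMF hPieceAn
  have hadd : PieceAdditiveOn Adm P := pieceAdditiveOn_mono hAdmAn hA16
  have haddMF : PieceAdditiveOn {H | H ∈ analyticClass R ∧ H ∈ S ∧ ∀ j, r j (restrictScale j H) = 0} P :=
    pieceAdditiveOn_mono hMF hA16
  exact termSize_ne9_and_fadingMemory_of_couplingTwoPoint_vacSub_sizeInduction_margProj_cpieceForm G P ρ U₀ explZ h0 hAdm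
    hres hrA hr0 hrs hA hcr haA hPinto hP0 hloc hsrc hadd haddMF hPiece hL hAmul hrespE hrespA hKp hqc hqcA hO1 hgain hcQ hω0
    hω1 hNb hfac hclip0 hCup hreprV hclipb hK hdec hpin hρ hexplZ hbase hNsucc hNnn hbox hB hlipb hpos

/-! ## §2 The `…_margProj` face for a piece form bounded on the analytic class — MP / S-sum / S5 discharged, A3 as `hTcup` -/

/-- **THE `…_margProj` FACE FOR A CLASS-RELATIVE PIECE FORM BOUNDED ON THE ANALYTIC CLASS — rows MP, S-sum, S5 DISCHARGED, A3
displayed as `hTcup` (kernel end-to-end; datum-generic form of p213217 §4 = of the owner's part 3 composed with END-M's route).**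
END-M's `…_compProj` face (`NE9MarginalProjectionEnd`) APPLIED BY NAME at `𝒯 := cpieceChannel P`, `P := margProj r A`, `MF :=
{H | H ∈ analyticClass R ∧ H ∈ S ∧ ∀ j, r_j(H↾j) = 0}`, `c := cr·aA`, `wt := weightOf P.frame κ₁ d₀ O1 Kp`, `τ := tauOfG c_Q
(agePow ω)`, with: `ChannelStepSum MF 𝒯` := `channelStepSum_cpiece hP0 hloc hsrc`; `ChannelSizeAtStepNN MF 𝒯 κ wt τ` := the
owner's `channelSizeAtStepNN_cpieceG` from the DISPLAYED per-piece bound on the analytic class restricted to `MF`;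
`ChannelAdditive MF 𝒯` := `channelAdditive_cpiece` from the displayed `PieceAdditiveOn (analyticClass R) P` restricted; the
profile from `profileG` (τ̄ = c_Q); the four projection binders := `projAdditive_margProj` (RO additivity) / `projScaleComm_margProj`
(`ReadZero`) / **p213217 §2** / `projSize_margProj` (`ReadSize` + `DirSize`).  DISPLAYED: `hP0 hloc hsrc hPieceAn hKp hgain`,
`LevelCountsG`, `Adm ⊆ analyticClass R`, AW, RO (+ `hcoef`, `hnorm`), `hS`, `PieceAdditiveOn (analyticClass R) P`, `hTcup`
(leaf A3), the face's A1/A2/R/G/N binders VERBATIM.  Conclusion LITERALLY END-M `…_margProj`'s with `τbar := c_Q`.  Instances: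
ray datum = p213217 §4; curve datum = crew row (w21)-MP.  Nothing of [I]–[II] asserted; NE9 NOT PROVED; 0/9 unchanged.
[cite: Balaban1987RG1, (0.28)-(0.30) p.258, (1.3) p.260, (1.18) p.263, (1.20)-(1.22) p.264, (3.53)-(3.54) p.280; Balaban1988RG2Cluster, (1.23)-(1.29) pp.7-8, (1.33)-(1.36) p.9] -/
theorem termSize_ne9_and_fadingMemory_analytic_margProj
    (P : CPieceData (doubleCarriers C₀) E ι α β γ) {R : C₀.Dom → ℝ} {Kp : ℕ → ι → ℝ} {gain : ℕ → ℕ → ℝ}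
    {Ef : Functional (doubleCarriers C₀) E} {W : Set (ℕ → ℝ)} {Adm S : Set (E → (doubleCarriers C₀).Dom → ℝ)}
    {r : ℕ → (E → (doubleCarriers C₀).Dom → ℝ) → ℝ} {A : E → (doubleCarriers C₀).Dom → ℝ}
    {Ψ : ℕ → ℝ → (ι → ℝ) → E → (doubleCarriers C₀).Dom → ℝ} {act : ℕ → ℝ → E → Pot → G.P → ℂ} {𝒜 : ℕ → Set Pot}
    {n : ℕ → ℝ → E → G.P → ℝ} {lip clip : ℕ → ℝ} {a d : G.P → ℝ} {δv : (doubleCarriers C₀).Dom → ℝ}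
    {κ κ₁ d0 O1 cQ B lipbar clipbar qTbar ω cr aA : ℝ} {qT p₀ N : ℕ → ℝ}
    -- the piece form's structure binders and ITS PER-PIECE BOUND ON THE ANALYTIC CLASS (displayed), counts, class inclusion
    (hP0 : PieceZero P) (hloc : PieceLocal P) (hsrc : CSrcScale P)
    (hPieceAn : PieceBoundOnG (analyticClass R) P κ κ₁ d0 Kp gain) (hKp : ∀ k y, 0 ≤ Kp k y) (hgain : ∀ k j, 0 ≤ gain k j)
    (hL : LevelCountsG P.frame κ κ₁ O1 cQ gain (agePow ω)) (hO1 : 0 ≤ O1) (hcQ : 0 ≤ cQ)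
    (hAdmAn : Adm ⊆ analyticClass R)
    -- additivity of the pieces on the analytic class (displayed; crew rows (w16)/(w19))
    (hA16 : PieceAdditiveOn (analyticClass R) P)
    -- the face's binders, verbatim …
    (ρ : ℕ → (ι → ℝ) → Pot) (U₀ : E) (explZ : ℕ → E → (doubleCarriers C₀).Dom → ℝ) (h0 : ScaleZeroFree Ef W)
    (hAdm : AdmissibleTerms Ef W Adm) (hres : AdmRestrict Adm)
    -- … with END-M's RO / AW binders in place of the four projection binders …
    (hrA : ReadAdditive Adm r) (hr0 : ReadZero r) (hrs : ReadSize Adm r κ cr) (hA : DirSize A κ aA) (hcr : 0 ≤ cr)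
    (haA : 0 ≤ aA)
    -- … and what MP needs (p213217 §2)
    (hAan : A ∈ analyticClass R)
    (hAmul : ∀ c : ℕ → ℝ, (fun U X' => c ((doubleCarriers C₀).scale X') * A U X') ∈ Adm)
    (hcoef : ∀ (j : ℕ) (c : ℝ), r j (restrictScale j (c • A)) = c * r j (restrictScale j A))
    (hnorm : ∀ j : ℕ, r j (restrictScale j A) = 1 ∨ ∀ H ∈ Adm, r j (restrictScale j H) = 0)
    (hS : ∀ H ∈ Adm, margProj r A H ∈ S)
    (hfac : Factorises Ef W (compProj (cpieceChannel P) (margProj r A)) Ψ) (hclip0 : ∀ k, 0 ≤ clip k)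
    (hCup : ∀ g ∈ W, ∀ g' ∈ W, ∀ (k : ℕ) (U : E) (X : (doubleCarriers C₀).Dom), (doubleCarriers C₀).scale X = k + 1 →
      ∀ Q ∈ 𝒜 k, ∀ γ' ∈ G.vol X,
      ‖act k (g k) U Q γ'‖ ≤ n k (g' k) U γ' ∧
        ‖act k (g k) U Q γ' - act k (g' k) U Q γ'‖ ≤ clip k * |g k - g' k| * n k (g' k) U γ')
    (hqT0 : ∀ k, 0 ≤ qT k)
    (hTcup : ∀ g ∈ W, ∀ g' ∈ W, ∀ (k : ℕ) (y : ι),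
      |compProj (cpieceChannel P) (margProj r A) k g (Ef g) y - compProj (cpieceChannel P) (margProj r A) k g' (Ef g) y| ≤
        weightOf P.frame κ₁ d0 O1 Kp k y * (qT k * |g k - g' k|))
    (hreprV : ∀ (k : ℕ) (s : ℝ) (Q : ι → ℝ) (U : E) (X : (doubleCarriers C₀).Dom),
      Ψ k s Q U X = (G.newTerm act k s U X (ρ k Q)).re - (G.newTerm act k s U₀ X (ρ k Q)).re + explZ k U X)
    (hclipb : ∀ k, clip k ≤ clipbar) (hqTb : ∀ k, qT k ≤ qTbar)
    (hK : TwoPointKP G W act 𝒜 n lip a d) (hdec : G.DecayExtract δv d) (hpin : G.PinBudget a δv (fun _ => B) κ)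
    (hρ : ∀ (k : ℕ) (Q Q' : ι → ℝ) (M : ℝ),
      (∀ y, |Q y - Q' y| ≤ weightOf P.frame κ₁ d0 O1 Kp k y * M) → ‖ρ k Q - ρ k Q'‖ ≤ M)
    (hexplZ : ∀ (k : ℕ) (U : E) (X : (doubleCarriers C₀).Dom), (doubleCarriers C₀).scale X = k + 1 →
      |explZ k U X| ≤ Real.exp (-(κ * (doubleCarriers C₀).d X)) * p₀ k)
    (hbase : ∀ g ∈ W, ∀ (U : E) (X : (doubleCarriers C₀).Dom), (doubleCarriers C₀).scale X = 0 →
      |Ef g U X| ≤ Real.exp (-(κ * (doubleCarriers C₀).d X)) * N 0)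
    (hNsucc : ∀ j, p₀ j + 2 * B ≤ N (j + 1)) (hNnn : ∀ j, 0 ≤ N j)
    (hbox : ∀ (k : ℕ) (Q : ι → ℝ), (∀ y, |Q y| ≤ weightOf P.frame κ₁ d0 O1 Kp k y *
      sizeRadius (fun k j => (1 + cr * aA) * tauOfG cQ (agePow ω) k j) N k) → ρ k Q ∈ 𝒜 k)
    (hB : 0 ≤ B) (hlipb : ∀ k, lip k ≤ lipbar) (hω : 0 ≤ ω)
    (hpos : 0 < ω + 8 * lipbar * B * ((1 + cr * aA) * cQ)) :
    TermSize Ef W κ N ∧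
      NE9 Ef W κ (prodModuli (8 * clipbar * B + 8 * lipbar * B * qTbar)
        fun _ => ω + 8 * lipbar * B * ((1 + cr * aA) * cQ)) ∧
        FadingMemory ((8 * clipbar * B + 8 * lipbar * B * qTbar) / (ω + 8 * lipbar * B * ((1 + cr * aA) * cQ)))
          (ω + 8 * lipbar * B * ((1 + cr * aA) * cQ))
          (prodModuli (8 * clipbar * B + 8 * lipbar * B * qTbar) fun _ => ω + 8 * lipbar * B * ((1 + cr * aA) * cQ)) := by
  -- MP (p213217 §2) and the class inclusion
  have hPinto : ProjInto Adm {H | H ∈ analyticClass R ∧ H ∈ S ∧ ∀ j, r j (restrictScale j H) = 0} (margProj r A) :=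
    projInto_margProj_analytic hAdmAn hAan hAmul hrA hcoef hnorm hS
  have hMF := margFree_subset_analyticClass (E := E) R S r
  -- the S-binders on MF, by name (the owner's part-3 route, datum-free)
  have hcQℓ : ∀ k j, 0 ≤ cQ * agePow ω k j := fun k j => mul_nonneg hcQ (agePow_nonneg hω k j)
  have hsum : ChannelStepSum {H | H ∈ analyticClass R ∧ H ∈ S ∧ ∀ j, r j (restrictScale j H) = 0} (cpieceChannel P) :=
    channelStepSum_cpiece hP0 hloc hsrc _
  have hstep : ChannelSizeAtStepNN {H | H ∈ analyticClass R ∧ H ∈ S ∧ ∀ j, r j (restrictScale j H) = 0} (cpieceChannel P) κ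
      (weightOf P.frame κ₁ d0 O1 Kp) (tauOfG cQ (agePow ω)) :=
    channelSizeAtStepNN_cpieceG hP0 hloc hsrc (pieceBoundOnG_mono hMF hPieceAn) hL hKp hO1 hgain hcQℓ
  have hadd : ChannelAdditive {H | H ∈ analyticClass R ∧ H ∈ S ∧ ∀ j, r j (restrictScale j H) = 0} (cpieceChannel P) :=
    channelAdditive_cpiece (pieceAdditiveOn_mono hMF hA16)
  have hτ : ∀ k j, j ≤ k → 0 ≤ tauOfG cQ (agePow ω) k j ∧ tauOfG cQ (agePow ω) k j ≤ cQ * ω ^ (k - j) :=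
    fun k j hjk => ⟨hcQℓ k j, (profileG hcQ hω).1 k j hjk⟩
  -- END-M's `…_compProj` face at `P := margProj r A` with the four projection binders supplied (its own route to `…_margProj`)
  exact ne9_and_fadingMemory_of_couplingTwoPoint_vacSub_sizeInduction_compProj G ρ U₀ explZ h0 hAdm hres
    (projAdditive_margProj A hrA) (projScaleComm_margProj Adm A hr0) hPinto (projSize_margProj hrs hA hcr) (mul_nonneg hcr haA)
    hadd hsum hstep hfac hclip0 hCup hqT0 hTcup hreprV hclipb hqTb hK hdec hpin hρ hexplZ hbase hNsucc hNnn hbox hB hlipb hcQ hω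
    hpos hτ


/-! ## §3 (v1.1) The `…_margProj` face at CHANNEL level on the analytic class — MP discharged for ANY channel -/

section Channel

variable {Bg' : Type}

/-- `ChannelStepSum` is antitone in the admissible class (companion of the owner's `channelSizeAtStepNN_mono` /
`channelAdditive_mono`). [folklore] -/
theorem channelStepSum_mono {C : Carriers} {Adm Adm' : Set (Bg' → C.Dom → ℝ)} (hsub : Adm' ⊆ Adm)
    {T : ℕ → (ℕ → ℝ) → (Bg' → C.Dom → ℝ) → ι → ℝ} (h : ChannelStepSum Adm T) : ChannelStepSum Adm' T :=
  fun k s H hH y => h k s H (hsub hH) y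

end Channel

/-- **THE `…_margProj` FACE AT CHANNEL LEVEL ON THE ANALYTIC CLASS — row MP DISCHARGED FOR ANY CHANNEL (v1.1; kernel end-to-end).**
END-M's `…_margProj` face (`NE9MarginalProjectionEnd`) APPLIED BY NAME at `MF := {H | H ∈ analyticClass R ∧ H ∈ S ∧ ∀ j, r_j(H↾j)
= 0}` with **`hPinto` := p213217 §2 `projInto_margProj_analytic`** and the three channel binders on `MF` RESTRICTED from the DISPLAYED
binders ON THE ANALYTIC CLASS — `haddAn : ChannelAdditive (analyticClass R) 𝒯`, `hsumAn : ChannelStepSum (analyticClass R) 𝒯`,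
`hstepAn : ChannelSizeAtStepNN (analyticClass R) 𝒯 κ wt τ` (antitonicity: `channelAdditive_mono`, `channelStepSum_mono`,
`channelSizeAtStepNN_mono`).  So the MP discharge needs NOTHING of the channel but its S-binders on the analytic class: it serves
the one-rate piece forms (§2 is the instance `𝒯 := cpieceChannel P` via `channelSizeAtStepNN_cpieceG`), the owner's TWO-RATE
kernel species (`channelSizeAtStepNN_ker` via `channelSizeAtStepNN_cpieceG₂`, p214202/p214232), and SUMS of species channels
(`NE9ChannelSum.channelAdditive_add` / `channelStepSum_add` / `channelSizeAtStepNN_add` at `Adm := analyticClass R`, p214415; the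
END faces at a sum `NE9ChannelSumMargProj`, p214472) alike.  DISPLAYED: the three S-binders on the analytic class, the profile
`hτ`/`hτbar`/`hω`, `Adm ⊆ analyticClass R`, AW (`DirSize A κ aA`, `A ∈ analyticClass R`, `hAmul`), RO (`hrA hr0 hrs` + `hcoef` +
NORMALISATION `hnorm`), the S-closure `hS`, leaf A3's `hTcup`, and END-M's A1/A2/R/G/N binders VERBATIM.  Conclusion LITERALLY END-M
`…_margProj`'s.  Nothing of [I]–[II] asserted; NE9 NOT PROVED; 0/9 unchanged.
[cite: Balaban1987RG1, (0.28)-(0.30) p.258, (1.3) p.260, (1.18) p.263, (1.20)-(1.22) p.264; Balaban1988RG2Cluster, (1.33)-(1.36) p.9] -/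
theorem termSize_ne9_and_fadingMemory_analyticChannel_margProj
    {R : C₀.Dom → ℝ} {𝒯 : ℕ → (ℕ → ℝ) → (E → (doubleCarriers C₀).Dom → ℝ) → ι → ℝ}
    {Ef : Functional (doubleCarriers C₀) E} {W : Set (ℕ → ℝ)} {Adm S : Set (E → (doubleCarriers C₀).Dom → ℝ)}
    {r : ℕ → (E → (doubleCarriers C₀).Dom → ℝ) → ℝ} {A : E → (doubleCarriers C₀).Dom → ℝ}
    {Ψ : ℕ → ℝ → (ι → ℝ) → E → (doubleCarriers C₀).Dom → ℝ} {act : ℕ → ℝ → E → Pot → G.P → ℂ} {𝒜 : ℕ → Set Pot}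
    {n : ℕ → ℝ → E → G.P → ℝ} {lip clip : ℕ → ℝ} {a d : G.P → ℝ} {δv : (doubleCarriers C₀).Dom → ℝ}
    {κ B lipbar clipbar qTbar τbar ω cr aA : ℝ} {wt : ℕ → ι → ℝ} {τ : ℕ → ℕ → ℝ} {qT p₀ N : ℕ → ℝ}
    -- the channel's S-binders ON THE ANALYTIC CLASS (displayed; producers: `channelSizeAtStepNN_cur` / `_ker` / `_cpieceG₂`,
    -- `NE9ChannelSum.…_add`, …) and the class inclusion
    (haddAn : ChannelAdditive (analyticClass R) 𝒯) (hsumAn : ChannelStepSum (analyticClass R) 𝒯)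
    (hstepAn : ChannelSizeAtStepNN (analyticClass R) 𝒯 κ wt τ) (hAdmAn : Adm ⊆ analyticClass R)
    -- the face's binders, verbatim …
    (ρ : ℕ → (ι → ℝ) → Pot) (U₀ : E) (explZ : ℕ → E → (doubleCarriers C₀).Dom → ℝ) (h0 : ScaleZeroFree Ef W)
    (hAdm : AdmissibleTerms Ef W Adm) (hres : AdmRestrict Adm)
    (hrA : ReadAdditive Adm r) (hr0 : ReadZero r) (hrs : ReadSize Adm r κ cr) (hA : DirSize A κ aA) (hcr : 0 ≤ cr)
    (haA : 0 ≤ aA)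
    -- … and what MP needs (p213217 §2)
    (hAan : A ∈ analyticClass R)
    (hAmul : ∀ c : ℕ → ℝ, (fun U X' => c ((doubleCarriers C₀).scale X') * A U X') ∈ Adm)
    (hcoef : ∀ (j : ℕ) (c : ℝ), r j (restrictScale j (c • A)) = c * r j (restrictScale j A))
    (hnorm : ∀ j : ℕ, r j (restrictScale j A) = 1 ∨ ∀ H ∈ Adm, r j (restrictScale j H) = 0)
    (hS : ∀ H ∈ Adm, margProj r A H ∈ S)
    (hfac : Factorises Ef W (compProj 𝒯 (margProj r A)) Ψ) (hclip0 : ∀ k, 0 ≤ clip k)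
    (hCup : ∀ g ∈ W, ∀ g' ∈ W, ∀ (k : ℕ) (U : E) (X : (doubleCarriers C₀).Dom), (doubleCarriers C₀).scale X = k + 1 →
      ∀ Q ∈ 𝒜 k, ∀ γ' ∈ G.vol X,
      ‖act k (g k) U Q γ'‖ ≤ n k (g' k) U γ' ∧
        ‖act k (g k) U Q γ' - act k (g' k) U Q γ'‖ ≤ clip k * |g k - g' k| * n k (g' k) U γ')
    (hqT0 : ∀ k, 0 ≤ qT k)
    (hTcup : ∀ g ∈ W, ∀ g' ∈ W, ∀ (k : ℕ) (y : ι),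
      |compProj 𝒯 (margProj r A) k g (Ef g) y - compProj 𝒯 (margProj r A) k g' (Ef g) y| ≤ wt k y * (qT k * |g k - g' k|))
    (hreprV : ∀ (k : ℕ) (s : ℝ) (Q : ι → ℝ) (U : E) (X : (doubleCarriers C₀).Dom),
      Ψ k s Q U X = (G.newTerm act k s U X (ρ k Q)).re - (G.newTerm act k s U₀ X (ρ k Q)).re + explZ k U X)
    (hclipb : ∀ k, clip k ≤ clipbar) (hqTb : ∀ k, qT k ≤ qTbar)
    (hK : TwoPointKP G W act 𝒜 n lip a d) (hdec : G.DecayExtract δv d) (hpin : G.PinBudget a δv (fun _ => B) κ)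
    (hρ : ∀ (k : ℕ) (Q Q' : ι → ℝ) (M : ℝ), (∀ y, |Q y - Q' y| ≤ wt k y * M) → ‖ρ k Q - ρ k Q'‖ ≤ M)
    (hexplZ : ∀ (k : ℕ) (U : E) (X : (doubleCarriers C₀).Dom), (doubleCarriers C₀).scale X = k + 1 →
      |explZ k U X| ≤ Real.exp (-(κ * (doubleCarriers C₀).d X)) * p₀ k)
    (hbase : ∀ g ∈ W, ∀ (U : E) (X : (doubleCarriers C₀).Dom), (doubleCarriers C₀).scale X = 0 →
      |Ef g U X| ≤ Real.exp (-(κ * (doubleCarriers C₀).d X)) * N 0)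
    (hNsucc : ∀ j, p₀ j + 2 * B ≤ N (j + 1)) (hNnn : ∀ j, 0 ≤ N j)
    (hbox : ∀ (k : ℕ) (Q : ι → ℝ),
      (∀ y, |Q y| ≤ wt k y * sizeRadius (fun k j => (1 + cr * aA) * τ k j) N k) → ρ k Q ∈ 𝒜 k)
    (hB : 0 ≤ B) (hlipb : ∀ k, lip k ≤ lipbar) (hτbar : 0 ≤ τbar) (hω : 0 ≤ ω)
    (hpos : 0 < ω + 8 * lipbar * B * ((1 + cr * aA) * τbar))
    (hτ : ∀ k j, j ≤ k → 0 ≤ τ k j ∧ τ k j ≤ τbar * ω ^ (k - j)) :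
    TermSize Ef W κ N ∧
      NE9 Ef W κ (prodModuli (8 * clipbar * B + 8 * lipbar * B * qTbar)
        fun _ => ω + 8 * lipbar * B * ((1 + cr * aA) * τbar)) ∧
        FadingMemory ((8 * clipbar * B + 8 * lipbar * B * qTbar) / (ω + 8 * lipbar * B * ((1 + cr * aA) * τbar)))
          (ω + 8 * lipbar * B * ((1 + cr * aA) * τbar))
          (prodModuli (8 * clipbar * B + 8 * lipbar * B * qTbar) fun _ => ω + 8 * lipbar * B * ((1 + cr * aA) * τbar)) := by
  have hMF := margFree_subset_analyticClass (E := E) R S r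
  exact ne9_and_fadingMemory_of_couplingTwoPoint_vacSub_sizeInduction_margProj G ρ U₀ explZ h0 hAdm hres hrA hr0 hrs hA hcr haA
    (projInto_margProj_analytic hAdmAn hAan hAmul hrA hcoef hnorm hS) (channelAdditive_mono hMF haddAn)
    (channelStepSum_mono hMF hsumAn) (channelSizeAtStepNN_mono hMF hstepAn) hfac hclip0 hCup hqT0 hTcup hreprV hclipb hqTb hK
    hdec hpin hρ hexplZ hbase hNsucc hNnn hbox hB hlipb hτbar hω hpos hτ

end Summit.QuantumFields.BalabanUV.T4Continuum.NE9AnalyticClassMargProj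

end
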